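import Summits.QuantumFields.BalabanUV.Beta.GAN24.CapacitanceEndpoint
import Summits.QuantumFields.BalabanUV.Beta.GAN24.BorderedFrameInverseBlocks

/-!
# `BalabanUV.Beta.GAN24.ArrowAnchorRealCap` — binder row G-an2-4 / (CONV-C), road P1-fibre, p1 row **P1-L10** `FibreStrip` ((I3′), the strip half of the
# K-slot), leaf-16's cut (M4) `L10-CUT-M4.md` row **F5 `ArrowAnchorReal`** (OUTER ANCHOR), PREP PART (iii): THE OUTER-SCALED INVERSE CAPACITANCE IS O(1)

NOT IN PRINT; OUR PROOF ATTEMPT.  HONEST FRAMING (cell contract, verbatim): «discharging `BetaPertH` makes Bałaban's UV stability UNCONDITIONAL — a real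
constructive-QFT result; it is NOT the continuum limit and NOT the Clay problem.»  HONEST DEPENDENCY (verbatim): «continuum YM on T⁴ ⇐ BetaPertH ∧ nine spine
estimates (0/9 proved); BetaPertH ⇐ (D1) ∧ (D4) ∧ CAP+tail; G-an2-4 gates asym, D1 and NE2/3/4.»  [folklore] bookkeeping over the cell's landed crux
`GAN24/CapacitanceEndpoint` (leaf-20, p1 row L08 `cap_lower`: the four N-uniform blockwise bounds of `(cap N p)⁻¹` at real `p ≠ 0`) and the L2-operator-norm
toolkit of `GAN24/BorderedFrameInverse(Blocks)` (leaf-16, E1) — every input BY NAME; no cited fact, no wall binder, no `def … : Prop`; the three `def`s are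
explicit scaling data + one displayed constant.  NOT summit progress: nothing of (CONV-C)'s K-slot `GAN24.CombesThomas.ConvCK 3 Lc` is discharged here (F5 is one
of the four anchor/Lipschitz inputs of F7 = (U1) on the road to EXACTLY (I3′)); 0 wall binders; NOT `BetaPertH`, NOT continuum, NOT Clay.

## What is proved (every `D`, every `N ≥ 1`, every `q ∈ [−π, π]^D` with `q ≠ 0`; `r₀ := √(momSq q) = |q|₂`)
Row F5's item (iii) in the OUTER SCALING of `L10-CUT-M4.md` §1 (global rows `Q × N^{−(D+1)}`, `M × r₀/N^{D+1}`; global columns `φ × r₀²/N³`, `c × r₀³/N³`;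
the same numbers as leaf-16's diagnostic `scaled_neumann.py`: `bQ, bM, aphi, ac`):
* `capS N q := diagonal rowScale · cap N (ofRealVec q) · diagonal colScale` — the outer-scaled (D+1)×(D+1) capacitance of T00's `AliasObjects.cap`;
* `isUnit_capS`, and the EXPLICIT inverse `capS_inv : (capS N q)⁻¹ = diagonal colScale⁻¹ · (cap N p)⁻¹ · diagonal rowScale⁻¹` (from `isUnit_cap_ofRealVec`);
* ENTRYWISE: `‖(capS⁻¹) (inl κ) (inl l)‖ ≤ cPP D`, `‖(capS⁻¹) (inl κ) (inr ·)‖ ≤ cPc D`, `‖(capS⁻¹) (inr ·) (inl l)‖ ≤ cPc D`, `‖(capS⁻¹) (inr ·) (inr ·)‖ ≤ ccc D` —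
  the four A4′(iii) orders `|q|², |q|³, |q|³, |q|⁴ /N^{D+4}` of `CapacitanceEndpoint.norm_cap_inv_*` are EXACTLY absorbed by the scalings (q- AND N-UNIFORM, no
  cancellation needed — `L10-CUT-M4.md` §1 «the four N13 orders … are EXACTLY what makes the scaled inverse O(1)»);
* **`norm_capS_inv_le : ‖(capS N q)⁻¹‖ ≤ bCap D`** with the displayed constant `bCap D = D²·cPP D + 2D·cPc D + ccc D` (L2 operator norm of
  `Matrix.Norms.L2Operator`, E1's `opNorm_le_sum_entries`).
Consumer: F5 proper (`ArrowAnchorReal`, this seat) feeds `bCap` as the `b` of F1's `ape_bordered` once F1 `ArrowOperator` (leaf-16-g6) identifies its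
scaled Schur complement `Σ_m V_m (T m)⁻¹ U_m` with `±capS` (the «T⁻¹ on the feed columns = Ablk/mublk with unit feeds» dictionary of the row text).
Unit `b2b-balaban-gan24-formalise-leaf-12` (G-an2-4 formalisation swarm, leaf prover 12, gen 7), 2026-08-20.  Value = kernel bookkeeping toward (I3′), NOT
summit progress.
-/

noncomputable section

open Complex Finset Matrix
open scoped BigOperators Real Matrix.Norms.L2Operator

namespace Summit.QuantumFields.BalabanUV.Beta.GAN24.ArrowAnchorRealCap

open Literature.MathematicalPhysics.QuantumFieldTheory.Balaban1983to89.B4Strip (ofRealVec)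
open Literature.MathematicalPhysics.QuantumFieldTheory.King1986 (momSq momSq_nonneg)
open AliasObjects (cap)
open CapacitanceScalarBounds (momSq_pos)
open CapacitanceEndpointBlocks (cPP cPc ccc cPP_pos cPc_pos ccc_pos)
open CapacitanceEndpoint (isUnit_cap_ofRealVec isUnit_cap_det_ofRealVec norm_cap_inv_inl_inl_le norm_cap_inv_inl_inr_le
  norm_cap_inv_inr_inl_le norm_cap_inv_inr_inr_le)
open BorderedFrameInverseBlocks (opNorm_le_sum_entries)

variable {D : ℕ}

/-! ## §1 The outer scaling of the global rows and columns -/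

/-- The OUTER RADIUS `r₀ = |q|₂ = √(Σ_i q_i²)`. -/
def rad (q : Fin D → ℝ) : ℝ := Real.sqrt (momSq q)

/-- [folklore] `0 ≤ r₀`. -/
theorem rad_nonneg (q : Fin D → ℝ) : 0 ≤ rad q := Real.sqrt_nonneg _

/-- [folklore] `r₀² = |q|²`. -/
theorem rad_sq (q : Fin D → ℝ) : rad q ^ 2 = momSq q := Real.sq_sqrt (momSq_nonneg q)

/-- [folklore] `0 < r₀` for `q ≠ 0`. -/
theorem rad_pos {q : Fin D → ℝ} (hq0 : q ≠ 0) : 0 < rad q := Real.sqrt_pos.2 (momSq_pos hq0)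

/-- [folklore] `r₀³ = |q|²·√|q|²` (the currency of `CapacitanceEndpoint.norm_cap_inv_inl_inr_le`). -/
theorem rad_pow_three (q : Fin D → ℝ) : rad q ^ 3 = momSq q * Real.sqrt (momSq q) := by
  rw [pow_succ, rad_sq]; rfl

/-- [folklore] `r₀⁴ = (|q|²)²`. -/
theorem rad_pow_four (q : Fin D → ℝ) : rad q ^ 4 = momSq q ^ 2 := by
  rw [show (4 : ℕ) = 2 * 2 by norm_num, pow_mul, rad_sq]

/-- The ROW scaling of the global rows: `Q_κ ↦ N^{−(D+1)}`, `M ↦ r₀/N^{D+1}` (leaf-16's `bQ`, `bM`). -/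
def rowScale (N : ℕ) (q : Fin D → ℝ) : Fin D ⊕ Unit → ℝ :=
  Sum.elim (fun _ => ((N : ℝ) ^ (D + 1))⁻¹) (fun _ => rad q / (N : ℝ) ^ (D + 1))

/-- The COLUMN scaling of the global unknowns: `φ_κ ↦ r₀²/N³`, `c ↦ r₀³/N³` (leaf-16's `aphi`, `ac`). -/
def colScale (N : ℕ) (q : Fin D → ℝ) : Fin D ⊕ Unit → ℝ :=
  Sum.elim (fun _ => rad q ^ 2 / (N : ℝ) ^ 3) (fun _ => rad q ^ 3 / (N : ℝ) ^ 3)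

/-- [folklore] Unfolding: the `Q`-row scale. -/
@[simp] theorem rowScale_inl (N : ℕ) (q : Fin D → ℝ) (κ : Fin D) : rowScale N q (Sum.inl κ) = ((N : ℝ) ^ (D + 1))⁻¹ := rfl
/-- [folklore] Unfolding: the `M`-row scale. -/
@[simp] theorem rowScale_inr (N : ℕ) (q : Fin D → ℝ) (u : Unit) : rowScale N q (Sum.inr u) = rad q / (N : ℝ) ^ (D + 1) := rfl
/-- [folklore] Unfolding: the `φ`-column scale. -/
@[simp] theorem colScale_inl (N : ℕ) (q : Fin D → ℝ) (κ : Fin D) : colScale N q (Sum.inl κ) = rad q ^ 2 / (N : ℝ) ^ 3 := rfl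
/-- [folklore] Unfolding: the `c`-column scale. -/
@[simp] theorem colScale_inr (N : ℕ) (q : Fin D → ℝ) (u : Unit) : colScale N q (Sum.inr u) = rad q ^ 3 / (N : ℝ) ^ 3 := rfl

/-- [folklore] Every row scale is positive (`N ≥ 1`, `q ≠ 0`). -/
theorem rowScale_pos {N : ℕ} (hN : 1 ≤ N) {q : Fin D → ℝ} (hq0 : q ≠ 0) (i : Fin D ⊕ Unit) : 0 < rowScale N q i := by
  have hN0 : (0 : ℝ) < N := by exact_mod_cast hN
  have hr := rad_pos hq0
  rcases i with κ | u
  · rw [rowScale_inl]; positivity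
  · rw [rowScale_inr]; positivity

/-- [folklore] Every column scale is positive (`N ≥ 1`, `q ≠ 0`). -/
theorem colScale_pos {N : ℕ} (hN : 1 ≤ N) {q : Fin D → ℝ} (hq0 : q ≠ 0) (j : Fin D ⊕ Unit) : 0 < colScale N q j := by
  have hN0 : (0 : ℝ) < N := by exact_mod_cast hN
  have hr := rad_pos hq0
  rcases j with κ | u
  · rw [colScale_inl]; positivity
  · rw [colScale_inr]; positivity

/-! ## §2 The outer-scaled capacitance and its explicit inverse -/

/-- **THE OUTER-SCALED CAPACITANCE** `capS N q = diagonal rowScale · cap N (ofRealVec q) · diagonal colScale` (T00's `AliasObjects.cap`). -/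
def capS (N : ℕ) [NeZero N] (q : Fin D → ℝ) : Matrix (Fin D ⊕ Unit) (Fin D ⊕ Unit) ℂ :=
  diagonal (fun i => ((rowScale N q i : ℝ) : ℂ)) * cap N (ofRealVec q) * diagonal (fun j => ((colScale N q j : ℝ) : ℂ))

/-- The candidate inverse: `diagonal colScale⁻¹ · (cap N p)⁻¹ · diagonal rowScale⁻¹`. -/
def capSInv (N : ℕ) [NeZero N] (q : Fin D → ℝ) : Matrix (Fin D ⊕ Unit) (Fin D ⊕ Unit) ℂ :=
  diagonal (fun i => (((colScale N q i)⁻¹ : ℝ) : ℂ)) * (cap N (ofRealVec q))⁻¹ * diagonal (fun j => (((rowScale N q j)⁻¹ : ℝ) : ℂ))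

variable {N : ℕ} [NeZero N] {q : Fin D → ℝ}

/-- [folklore] `capS · capSInv = 1` (`N ≥ 1`, `q ∈ [−π, π]^D ∖ {0}`; `cap` invertible by `CapacitanceEndpoint.isUnit_cap_det_ofRealVec`). -/
theorem capS_mul_capSInv (hN : 1 ≤ N) (hq : ∀ i, |q i| ≤ π) (hq0 : q ≠ 0) : capS N q * capSInv N q = 1 := by
  have hdet := isUnit_cap_det_ofRealVec (D := D) (N := N) hN hq hq0
  have hc : ∀ j, ((colScale N q j : ℝ) : ℂ) * (((colScale N q j)⁻¹ : ℝ) : ℂ) = 1 := fun j => by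
    rw [← Complex.ofReal_mul, mul_inv_cancel₀ (colScale_pos hN hq0 j).ne', Complex.ofReal_one]
  have hr : ∀ i, ((rowScale N q i : ℝ) : ℂ) * (((rowScale N q i)⁻¹ : ℝ) : ℂ) = 1 := fun i => by
    rw [← Complex.ofReal_mul, mul_inv_cancel₀ (rowScale_pos hN hq0 i).ne', Complex.ofReal_one]
  unfold capS capSInv
  calc diagonal (fun i => ((rowScale N q i : ℝ) : ℂ)) * cap N (ofRealVec q) * diagonal (fun j => ((colScale N q j : ℝ) : ℂ)) *
        (diagonal (fun i => (((colScale N q i)⁻¹ : ℝ) : ℂ)) * (cap N (ofRealVec q))⁻¹ * diagonal (fun j => (((rowScale N q j)⁻¹ : ℝ) : ℂ)))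
      = diagonal (fun i => ((rowScale N q i : ℝ) : ℂ)) * (cap N (ofRealVec q) *
          ((diagonal (fun j => ((colScale N q j : ℝ) : ℂ)) * diagonal (fun i => (((colScale N q i)⁻¹ : ℝ) : ℂ))) *
            (cap N (ofRealVec q))⁻¹)) * diagonal (fun j => (((rowScale N q j)⁻¹ : ℝ) : ℂ)) := by
        simp only [Matrix.mul_assoc]
    _ = 1 := by
        rw [diagonal_mul_diagonal, show (fun i => ((colScale N q i : ℝ) : ℂ) * (((colScale N q i)⁻¹ : ℝ) : ℂ)) = fun _ => 1 from funext hc,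
          diagonal_one, Matrix.one_mul, Matrix.mul_nonsing_inv _ hdet, Matrix.mul_one, diagonal_mul_diagonal,
          show (fun i => ((rowScale N q i : ℝ) : ℂ) * (((rowScale N q i)⁻¹ : ℝ) : ℂ)) = fun _ => 1 from funext hr, diagonal_one]

/-- [folklore] **`capS` IS INVERTIBLE** at every real `q ∈ [−π, π]^D ∖ {0}`, every `N ≥ 1`. -/
theorem isUnit_capS (hN : 1 ≤ N) (hq : ∀ i, |q i| ≤ π) (hq0 : q ≠ 0) : IsUnit (capS N q) := by
  have h := capS_mul_capSInv hN hq hq0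
  have hdet : IsUnit (capS N q).det :=
    IsUnit.of_mul_eq_one (capSInv N q).det (by rw [← Matrix.det_mul, h, Matrix.det_one])
  exact (Matrix.isUnit_iff_isUnit_det _).mpr hdet

/-- [folklore] **THE EXPLICIT INVERSE**: `(capS N q)⁻¹ = diagonal colScale⁻¹ · (cap N p)⁻¹ · diagonal rowScale⁻¹`. -/
theorem capS_inv (hN : 1 ≤ N) (hq : ∀ i, |q i| ≤ π) (hq0 : q ≠ 0) : (capS N q)⁻¹ = capSInv N q :=
  Matrix.inv_eq_right_inv (capS_mul_capSInv hN hq hq0)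

/-- [folklore] Entries of the inverse: `(capS⁻¹) i j = colScale(i)⁻¹ · (cap⁻¹) i j · rowScale(j)⁻¹`. -/
theorem capS_inv_apply (hN : 1 ≤ N) (hq : ∀ i, |q i| ≤ π) (hq0 : q ≠ 0) (i j : Fin D ⊕ Unit) :
    (capS N q)⁻¹ i j = (((colScale N q i)⁻¹ : ℝ) : ℂ) * (cap N (ofRealVec q))⁻¹ i j * (((rowScale N q j)⁻¹ : ℝ) : ℂ) := by
  rw [capS_inv hN hq hq0]
  unfold capSInv
  rw [mul_diagonal, diagonal_mul]

/-- [folklore] Norm of an inverse entry: `‖(capS⁻¹) i j‖ = colScale(i)⁻¹ · ‖(cap⁻¹) i j‖ · rowScale(j)⁻¹`. -/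
theorem norm_capS_inv_apply (hN : 1 ≤ N) (hq : ∀ i, |q i| ≤ π) (hq0 : q ≠ 0) (i j : Fin D ⊕ Unit) :
    ‖(capS N q)⁻¹ i j‖ = (colScale N q i)⁻¹ * ‖(cap N (ofRealVec q))⁻¹ i j‖ * (rowScale N q j)⁻¹ := by
  rw [capS_inv_apply hN hq hq0, norm_mul, norm_mul, Complex.norm_real, Complex.norm_real,
    Real.norm_of_nonneg (inv_nonneg.2 (colScale_pos hN hq0 i).le), Real.norm_of_nonneg (inv_nonneg.2 (rowScale_pos hN hq0 j).le)]

/-! ## §3 The four blocks of the scaled inverse are O(1): the A4′(iii) orders are exactly absorbed -/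

/-- **`φφ` BLOCK**: `‖(capS⁻¹) (inl κ) (inl l)‖ ≤ cPP D` (`(N³/r₀²)·(cPP·|q|²/N^{D+4})·N^{D+1} = cPP`). [folklore] -/
theorem norm_capS_inv_inl_inl_le (hN : 1 ≤ N) (hq : ∀ i, |q i| ≤ π) (hq0 : q ≠ 0) (κ l : Fin D) :
    ‖(capS N q)⁻¹ (Sum.inl κ) (Sum.inl l)‖ ≤ cPP D := by
  have hN0 : (0 : ℝ) < N := by exact_mod_cast hN
  have hm := momSq_pos hq0
  rw [norm_capS_inv_apply hN hq hq0, colScale_inl, rowScale_inl, inv_inv, rad_sq]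
  have h := norm_cap_inv_inl_inl_le (D := D) (N := N) hN hq hq0 κ l
  calc (momSq q / (N : ℝ) ^ 3)⁻¹ * ‖(cap N (ofRealVec q))⁻¹ (Sum.inl κ) (Sum.inl l)‖ * (N : ℝ) ^ (D + 1)
      ≤ (momSq q / (N : ℝ) ^ 3)⁻¹ * (cPP D * momSq q / (N : ℝ) ^ (D + 4)) * (N : ℝ) ^ (D + 1) :=
        mul_le_mul_of_nonneg_right (mul_le_mul_of_nonneg_left h (by positivity)) (by positivity)
    _ = cPP D := by field_simp; ring

/-- **`φc` COLUMN**: `‖(capS⁻¹) (inl κ) (inr u)‖ ≤ cPc D` (`(N³/r₀²)·(cPc·r₀³/N^{D+4})·(N^{D+1}/r₀) = cPc`). [folklore] -/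
theorem norm_capS_inv_inl_inr_le (hN : 1 ≤ N) (hq : ∀ i, |q i| ≤ π) (hq0 : q ≠ 0) (κ : Fin D) (u : Unit) :
    ‖(capS N q)⁻¹ (Sum.inl κ) (Sum.inr u)‖ ≤ cPc D := by
  have hN0 : (0 : ℝ) < N := by exact_mod_cast hN
  have hm := momSq_pos hq0
  have hr := rad_pos hq0
  rw [norm_capS_inv_apply hN hq hq0, colScale_inl, rowScale_inr]
  have h := norm_cap_inv_inl_inr_le (D := D) (N := N) hN hq hq0 κ u
  rw [← rad_pow_three] at h
  calc (rad q ^ 2 / (N : ℝ) ^ 3)⁻¹ * ‖(cap N (ofRealVec q))⁻¹ (Sum.inl κ) (Sum.inr u)‖ * (rad q / (N : ℝ) ^ (D + 1))⁻¹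
      ≤ (rad q ^ 2 / (N : ℝ) ^ 3)⁻¹ * (cPc D * rad q ^ 3 / (N : ℝ) ^ (D + 4)) * (rad q / (N : ℝ) ^ (D + 1))⁻¹ :=
        mul_le_mul_of_nonneg_right (mul_le_mul_of_nonneg_left h (by positivity)) (by positivity)
    _ = cPc D := by field_simp; ring

/-- **`cφ` ROW**: `‖(capS⁻¹) (inr u) (inl l)‖ ≤ cPc D` (`(N³/r₀³)·(cPc·r₀³/N^{D+4})·N^{D+1} = cPc`). [folklore] -/
theorem norm_capS_inv_inr_inl_le (hN : 1 ≤ N) (hq : ∀ i, |q i| ≤ π) (hq0 : q ≠ 0) (u : Unit) (l : Fin D) :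
    ‖(capS N q)⁻¹ (Sum.inr u) (Sum.inl l)‖ ≤ cPc D := by
  have hN0 : (0 : ℝ) < N := by exact_mod_cast hN
  have hm := momSq_pos hq0
  have hr := rad_pos hq0
  rw [norm_capS_inv_apply hN hq hq0, colScale_inr, rowScale_inl, inv_inv]
  have h := norm_cap_inv_inr_inl_le (D := D) (N := N) hN hq hq0 u l
  rw [← rad_pow_three] at h
  calc (rad q ^ 3 / (N : ℝ) ^ 3)⁻¹ * ‖(cap N (ofRealVec q))⁻¹ (Sum.inr u) (Sum.inl l)‖ * (N : ℝ) ^ (D + 1)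
      ≤ (rad q ^ 3 / (N : ℝ) ^ 3)⁻¹ * (cPc D * rad q ^ 3 / (N : ℝ) ^ (D + 4)) * (N : ℝ) ^ (D + 1) :=
        mul_le_mul_of_nonneg_right (mul_le_mul_of_nonneg_left h (by positivity)) (by positivity)
    _ = cPc D := by field_simp; ring

/-- **`cc` CORNER**: `‖(capS⁻¹) (inr u) (inr u')‖ ≤ ccc D` (`(N³/r₀³)·(ccc·r₀⁴/N^{D+4})·(N^{D+1}/r₀) = ccc`). [folklore] -/
theorem norm_capS_inv_inr_inr_le (hN : 1 ≤ N) (hq : ∀ i, |q i| ≤ π) (hq0 : q ≠ 0) (u u' : Unit) :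
    ‖(capS N q)⁻¹ (Sum.inr u) (Sum.inr u')‖ ≤ ccc D := by
  have hN0 : (0 : ℝ) < N := by exact_mod_cast hN
  have hm := momSq_pos hq0
  have hr := rad_pos hq0
  rw [norm_capS_inv_apply hN hq hq0, colScale_inr, rowScale_inr]
  have h := norm_cap_inv_inr_inr_le (D := D) (N := N) hN hq hq0 u u'
  rw [← rad_pow_four] at h
  calc (rad q ^ 3 / (N : ℝ) ^ 3)⁻¹ * ‖(cap N (ofRealVec q))⁻¹ (Sum.inr u) (Sum.inr u')‖ * (rad q / (N : ℝ) ^ (D + 1))⁻¹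
      ≤ (rad q ^ 3 / (N : ℝ) ^ 3)⁻¹ * (ccc D * rad q ^ 4 / (N : ℝ) ^ (D + 4)) * (rad q / (N : ℝ) ^ (D + 1))⁻¹ :=
        mul_le_mul_of_nonneg_right (mul_le_mul_of_nonneg_left h (by positivity)) (by positivity)
    _ = ccc D := by field_simp; ring

/-! ## §4 The operator-norm bound -/

/-- The displayed constant: `bCap D = D²·cPP D + 2D·cPc D + ccc D` (sum of the entry bounds over the `(D+1)×(D+1)` block pattern). -/
def bCap (D : ℕ) : ℝ := (D : ℝ) ^ 2 * cPP D + 2 * D * cPc D + ccc D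

/-- [folklore] `0 < bCap D`. -/
theorem bCap_pos (D : ℕ) : 0 < bCap D := by
  have h1 := cPP_pos D; have h2 := cPc_pos D; have h3 := ccc_pos D
  unfold bCap; positivity

/-- **THE OUTER-SCALED INVERSE CAPACITANCE IS O(1)** (row F5 (iii) of `L10-CUT-M4.md`): for every `N ≥ 1` and every `q ∈ [−π, π]^D ∖ {0}`,
`‖(capS N q)⁻¹‖ ≤ bCap D` in the L2 operator norm — q- and N-UNIFORM (E1's `opNorm_le_sum_entries` over the four blocks). [folklore] -/
theorem norm_capS_inv_le (hN : 1 ≤ N) (hq : ∀ i, |q i| ≤ π) (hq0 : q ≠ 0) : ‖(capS N q)⁻¹‖ ≤ bCap D := by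
  classical
  refine (opNorm_le_sum_entries _).trans ?_
  simp only [Fintype.sum_sum_type, Finset.sum_add_distrib]
  have h11 : ∑ κ : Fin D, ∑ l : Fin D, ‖(capS N q)⁻¹ (Sum.inl κ) (Sum.inl l)‖ ≤ (D : ℝ) ^ 2 * cPP D := by
    calc ∑ κ : Fin D, ∑ l : Fin D, ‖(capS N q)⁻¹ (Sum.inl κ) (Sum.inl l)‖ ≤ ∑ _κ : Fin D, ∑ _l : Fin D, cPP D :=
          Finset.sum_le_sum fun κ _ => Finset.sum_le_sum fun l _ => norm_capS_inv_inl_inl_le hN hq hq0 κ l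
      _ = (D : ℝ) ^ 2 * cPP D := by simp [Finset.sum_const, Finset.card_univ, Fintype.card_fin]; ring
  have h12 : ∑ κ : Fin D, ∑ u : Unit, ‖(capS N q)⁻¹ (Sum.inl κ) (Sum.inr u)‖ ≤ D * cPc D := by
    calc ∑ κ : Fin D, ∑ u : Unit, ‖(capS N q)⁻¹ (Sum.inl κ) (Sum.inr u)‖ ≤ ∑ _κ : Fin D, ∑ _u : Unit, cPc D :=
          Finset.sum_le_sum fun κ _ => Finset.sum_le_sum fun u _ => norm_capS_inv_inl_inr_le hN hq hq0 κ u
      _ = D * cPc D := by simp [Finset.sum_const, Finset.card_univ, Fintype.card_fin]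
  have h21 : ∑ u : Unit, ∑ l : Fin D, ‖(capS N q)⁻¹ (Sum.inr u) (Sum.inl l)‖ ≤ D * cPc D := by
    calc ∑ u : Unit, ∑ l : Fin D, ‖(capS N q)⁻¹ (Sum.inr u) (Sum.inl l)‖ ≤ ∑ _u : Unit, ∑ _l : Fin D, cPc D :=
          Finset.sum_le_sum fun u _ => Finset.sum_le_sum fun l _ => norm_capS_inv_inr_inl_le hN hq hq0 u l
      _ = D * cPc D := by simp [Finset.sum_const, Finset.card_univ, Fintype.card_fin]
  have h22 : ∑ u : Unit, ∑ u' : Unit, ‖(capS N q)⁻¹ (Sum.inr u) (Sum.inr u')‖ ≤ ccc D := by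
    calc ∑ u : Unit, ∑ u' : Unit, ‖(capS N q)⁻¹ (Sum.inr u) (Sum.inr u')‖ ≤ ∑ _u : Unit, ∑ _u' : Unit, ccc D :=
          Finset.sum_le_sum fun u _ => Finset.sum_le_sum fun u' _ => norm_capS_inv_inr_inr_le hN hq hq0 u u'
      _ = ccc D := by simp
  unfold bCap
  linarith

/-- [folklore] PACKAGED for F1's `ape_bordered` (its `b`): `IsUnit (capS N q) ∧ ‖(capS N q)⁻¹‖ ≤ bCap D`. -/
theorem capS_ape (hN : 1 ≤ N) (hq : ∀ i, |q i| ≤ π) (hq0 : q ≠ 0) : IsUnit (capS N q) ∧ ‖(capS N q)⁻¹‖ ≤ bCap D :=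
  ⟨isUnit_capS hN hq hq0, norm_capS_inv_le hN hq hq0⟩

end Summit.QuantumFields.BalabanUV.Beta.GAN24.ArrowAnchorRealCap

end
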